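import Summits.QuantumFields.YangMills.Theorems.BalabanUVNodesN15SiteReadout
import HarnessLib

/-!
# Route «BalabanUVNodes» (K4 «SpineRates»), node N15 = NE2 — THE UNIT-LATTICE-LAYER READOUT in the lineage's currency: block majorants `B₀·e^{−δ₀d}·θ^k` of a family
# of site-lattice operators ⇒ the node's THIRD CONJUNCT `T4EtaRate.EtaRateIneqUnit` ∕ `NE2PlusUnit` BY NAME, on n15-b's realised [B9] geometry `opGeo g X blk` — for
# ANY background carrier (the unit twin of `…N15SiteReadout`)

Cell `pub-ymgap`, seat `pub-ymgap-dag-n15-c` (generation g5; R134 ACCELERATION SEAT, strategy s1; HUMAN RULING D-0062; chair R424 venue; `bears_on: R4∕N15`).  Filed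
`--supports stmt-QuantumFields-20292 --as helper` (K3⁗; count-neutral).  Imports this seat's S3 `…N15SiteReadout` (`siteKernelOf`, `siteKernelOf_nonneg`,
`siteKernelOf_le_of_hasMaj`; through it n15-b `…N15OperatorReadout.opGeo` ∕ `realisedInstance`) BY NAME; nothing in the tree is modified.

THE PRINT (SHAPE only).  [Balaban1985BackgroundPropagators] Thm 3.15 (3.187) p. 432 (the unit-lattice covariance `C^{(k)}(Λ)` with a uniform majorant `B₀e^{−δ₀|y−y′|}`);
[King1986] Lemma 4.5 (4.38) p. 674 (the A = 0 η-rate template «|C^{(k)}(x, y) − C^{(k+n)}(x, y)| ≤ CL^{−k}e^{−δ₀|x−y|}»).  The typed shape `T4EtaRate.EtaRateIneqUnit` is the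
pointwise bound `|Kd(y, y′)| ≤ B₀e^{−δ₀·unitDist(y,y′)}·θ^k` on `Λ` (NOT PRINTED for Bałaban's `C^{(k)}(Λ; U)`).

CONTENTS ([folklore] plumbing + bookkeeping; 0 def).
* §1 `etaRateIneqUnit_opGeo_of_hasMaj` — one configuration: a block majorant `B₀·e^{−δ₀d}·θ^{k}` (`B₀, θ ≥ 0`) of `T U` between the sharp block norms of the site lattice
  IS `EtaRateIneqUnit (siteKernelOf blk blkY T) ⊤ d B₀ δ₀ θ k U` (largest block-pair entry; every site in `Λ`).
* §2 `ne2PlusUnit_opGeo_of_hasMaj` — the node's THIRD conjunct BY NAME for a family of realised instances over ANY backgrounds, from UNIFORM block majorants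
  `B₀·e^{−δ₀d}·θ^{k_i}` (`0 < θ < 1`) under the quantifier block of `NE2PlusUnit` (`0 < α₀`, `Mα₀ ≤ a₀`, (3.35); the (3.36) slot is not consumed).

HONEST FRAMING ∕ LIMITS.  Typing + bookkeeping: nothing about Bałaban's or King's covariances is asserted and no majorant is proved here (binders, produced for the
dressed unit covariance by this seat's `…N15BackgroundUnitWords` and instantiated in the sequel).  NE2⁺ NOT PRINTED, NOT proved; count-neutral (typed 28∕28; discharged
count unchanged); N15 NOT discharged; one finite T⁴ at fixed ε — NOT infinite volume, NOT OS on ℝ⁴, NOT a mass gap, NOT Clay.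
-/

noncomputable section

namespace Summit.QuantumFields.YangMills.BalabanUVNodes.N15.SiteLayer

open Literature.MathematicalPhysics.QuantumFieldTheory.Balaban1983to89
open Literature.MathematicalPhysics.QuantumFieldTheory.Balaban1983to89.B11SectG (BlockNorm HasMaj)
open Literature.MathematicalPhysics.QuantumFieldTheory.Balaban1983to89.T4EtaRate (PairedInstance EtaPairing EtaRateIneqUnit NE2PlusUnit)
open Summit.QuantumFields.YangMills.BalabanUVNodes.N15.OperatorReadout (opGeo realisedInstance)

/-! ## §1 One configuration -/

section Producers

variable {g : B6.Geometry} {X Y : Type} [Fintype X] [Fintype Y] [DecidableEq Y] (blk : X → g.Site) (blkY : Y → g.Site) {B : B9.Backgrounds}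

/-- **PRODUCER, one configuration.**  A block majorant `B₀·e^{−δ₀d(y,y′)}·θ^k` of `T U` between the sharp block norms of the site lattice (`B₀, θ ≥ 0`) IS the unit-lattice
inequality `EtaRateIneqUnit` for the site kernel of `T` on the realised geometry, with `inΛ = ⊤` and `unitDist = d`. [cite: Balaban1985BackgroundPropagators, Thm 3.15 (3.187) p.432 (shape); King1986, Lemma 4.5 (4.38) p.674 (template)] -/
theorem etaRateIneqUnit_opGeo_of_hasMaj {B₀ δ₀ θ : ℝ} (k : ℕ) (hB₀ : 0 ≤ B₀) (hθ : 0 ≤ θ) (T : B.Cfg → ((Y → ℝ) →ₗ[ℝ] (Y → ℝ))) (U : B.Cfg)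
    (h : HasMaj (BlockNorm.ofBlocks g blkY) (BlockNorm.ofBlocks g blkY) (T U) (fun y y' => B₀ * Real.exp (-(δ₀ * g.dist y y')) * θ ^ k)) :
    EtaRateIneqUnit (siteKernelOf blk blkY T) (fun _ => True) (opGeo g X blk).dist B₀ δ₀ θ k U := by
  intro y y' _ _
  have hK : ∀ a b : g.Site, 0 ≤ B₀ * Real.exp (-(δ₀ * g.dist a b)) * θ ^ k := fun a b =>
    mul_nonneg (mul_nonneg hB₀ (Real.exp_nonneg _)) (pow_nonneg hθ _)
  rw [abs_of_nonneg (siteKernelOf_nonneg blk blkY T U y y')]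
  exact siteKernelOf_le_of_hasMaj blk blkY T U hK h y y'

end Producers

/-! ## §2 The node's third conjunct BY NAME for a family of realised instances over ANY backgrounds -/

section Node

variable {I : Type} (g : I → B6.Geometry) (X : I → Type) [∀ i, Fintype (X i)] (Y : I → Type) [∀ i, Fintype (Y i)] [∀ i, DecidableEq (Y i)]
  (blk : ∀ i, X i → (g i).Site) (blkY : ∀ i, Y i → (g i).Site) (gf : I → B9.Geometry) (Bc Bf : I → B9.Backgrounds)
  (pair : ∀ i, EtaPairing (opGeo (g i) (X i) (blk i)) (gf i) (Bc i) (Bf i))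
  (T : ∀ i, (Bf i).Cfg → ((Y i → ℝ) →ₗ[ℝ] (Y i → ℝ)))

/-- **THE NODE'S THIRD CONJUNCT BY NAME.**  For a family of realised instances (`OperatorReadout.realisedInstance`) over ANY background carriers: UNIFORM constants
`δ₀, a₀, B₀ > 0`, `0 < θ < 1` and, for `0 < α₀`, `Mα₀ ≤ a₀` and every (3.35)-regular fine configuration `U`, the block majorant `B₀·e^{−δ₀d}·θ^{k_i}` of `T i U` ⟹
`T4EtaRate.NE2PlusUnit c35 pi (site kernels) ⊤ d` (the (3.36) slot of the quantifier block is not consumed). [cite: Balaban1985BackgroundPropagators, Thm 3.15 (3.187) p.432 (quantifier template); King1986, Lemma 4.5 (4.38) p.674 (template)] -/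
theorem ne2PlusUnit_opGeo_of_hasMaj (c35 : ℝ)
    (h : ∃ δ₀ a₀ B₀ θ : ℝ, 0 < δ₀ ∧ 0 < a₀ ∧ 0 < B₀ ∧ 0 < θ ∧ θ < 1 ∧
      ∀ i : I, ∀ α₀ : ℝ, 0 < α₀ → (gf i).M * α₀ ≤ a₀ →
        ∀ U : (Bf i).Cfg, (Bf i).Reg335 c35 α₀ U →
          HasMaj (BlockNorm.ofBlocks (g i) (blkY i)) (BlockNorm.ofBlocks (g i) (blkY i)) (T i U)
            (fun y y' => B₀ * Real.exp (-(δ₀ * (g i).dist y y')) * θ ^ (g i).k)) :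
    NE2PlusUnit c35 (realisedInstance g X blk gf Bc Bf pair) (fun i => siteKernelOf (blk i) (blkY i) (T i)) (fun _ _ => True)
      (fun i => (opGeo (g i) (X i) (blk i)).dist) := by
  obtain ⟨δ₀, a₀, B₀, θ, hδ₀, ha₀, hB₀, hθ, hθ1, hall⟩ := h
  refine ⟨δ₀, a₀, B₀, θ, hδ₀, ha₀, hB₀, hθ, hθ1, fun i α₀ hα₀ ha U hU _ => ?_⟩
  exact etaRateIneqUnit_opGeo_of_hasMaj (blk i) (blkY i) (g i).k hB₀.le hθ.le (T i) U (hall i α₀ hα₀ ha U hU)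

end Node

end Summit.QuantumFields.YangMills.BalabanUVNodes.N15.SiteLayer

end
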